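import Literature.NumberTheory.Transcendental.DrinfeldAssociatorGroupLikeProofs
import Literature.NumberTheory.Transcendental.MZVShuffleRegularisationProofs
import HarnessLib

/-!
# The Drinfeld associator IV: `Φ_KZ` is group-like (the named fact discharged)

Proofs file (theorems only: no definition, no statement change, no named fact) closing the named
fact `drinfeldAssociator_isGroupLike` of `DrinfeldAssociator.lean` [Drinfeld1991, §2; Furusho2003,
Property II (0)]:

  `theorem drinfeldAssociator_isGroupLike_holds : drinfeldAssociator_isGroupLike`.

The two inputs of the reduction `drinfeldAssociator_isGroupLike_of_shuffleReg`
(`DrinfeldAssociatorGroupLikeProofs.lean`: `Z` is a `ш`-character of `𝔥⁰` by the shuffle product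
formula of convergent multiple zeta values, and the sign `(-1)^{dp}` is multiplicative on shuffles)
are the two algebraic properties of IKZ's explicit regularisation `reg = MZV.shuffleReg`
[IharaKanekoZagier2006, §3 p. 314, Cor. 5], proved in `MZVShuffleRegularisationProofs.lean` from
the Taylor (constant-term) maps of the completed shuffle algebra (`ShuffleAlgebra.lean`):

* `reg_ш` is a `ш`-homomorphism — `MZV.shuffleRegFS_shuffleSum`, repackaged here as
  `MZV.sum_map_shuffleReg_eq_shuffleFS : Σ_{w ∈ u ш v} reg(w) = reg(u) ш reg(v)`;
* `reg_ш` takes values in `𝔥⁰` — `MZV.isConvergentWord_of_mem_support_shuffleReg`.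

Coefficientwise the theorem is the family of regularised shuffle relations of multiple zeta values
`Z(reg u) Z(reg v) = Σ_{w ∈ u ш v} Z(reg w)` [IharaKanekoZagier2006, Thm 1 (reg_ш form)].

## References

* V. G. Drinfel'd, *On quasitriangular quasi-Hopf algebras and on a group that is closely connected
  with Gal(Q̄/Q)*, Leningrad Math. J. 2 (1991), 829–860, §2. [Drinfeld1991]
* H. Furusho, *The multiple zeta value algebra and the stable derivation algebra*, Publ. RIMS 39
  (2003), Prop. 3.2.3, §3.3 Property II (0). [Furusho2003]
* K. Ihara, M. Kaneko, D. Zagier, *Derivation and double shuffle relations for multiple zeta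
  values*, Compositio Math. 142 (2006), §3 p. 314, Cor. 5, Thm 1. [IharaKanekoZagier2006]
-/

noncomputable section

namespace Literature.NumberTheory.Transcendental

/-- **`reg_ш(u ш v) = reg_ш(u) ш reg_ш(v)`** in the form consumed by
`drinfeldAssociator_isGroupLike_of_shuffleReg` (list sum of the `reg(w)`, `w ∈ u ш v`).
[cite: IharaKanekoZagier2006, §3 p. 314] -/
theorem MZV.sum_map_shuffleReg_eq_shuffleFS (u v : List Bool) :
    ((MZV.shuffleWord u v).map MZV.shuffleReg).sum =
      MZV.shuffleFS (MZV.shuffleReg u) (MZV.shuffleReg v) := by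
  rw [← MZV.shuffleRegFS_shuffleSum, MZV.shuffleSum, MZV.shuffleRegFS_wordSum]

/-- **Drinfeld's theorem, group-likeness of `Φ_KZ`** [Drinfeld1991, §2; Furusho2003,
Property II (0)]: the Drinfeld associator — defined coefficientwise by Furusho's formula
`c_W = (-1)^{dp W} Z(reg W)` [Furusho2003, Prop. 3.2.3] — is group-like: `c_∅ = 1` and
`c_u c_v = Σ_{w ∈ u ш v} c_w` for all binary words `u, v` (the regularised shuffle relations of
multiple zeta values). Assembled from `drinfeldAssociator_isGroupLike_of_shuffleReg` and the two
algebraic properties of IKZ's explicit regularisation: `reg_ш` is a `ш`-homomorphism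
(`MZV.shuffleRegFS_shuffleSum`) with values in `𝔥⁰` (`MZV.isConvergentWord_of_mem_support_shuffleReg`).
[cite: Drinfeld1991, §2] -/
theorem drinfeldAssociator_isGroupLike_holds : drinfeldAssociator_isGroupLike :=
  drinfeldAssociator_isGroupLike_of_shuffleReg MZV.sum_map_shuffleReg_eq_shuffleFS
    fun _ _ h => MZV.isConvergentWord_of_mem_support_shuffleReg (Finsupp.mem_support_iff.2 h)

end Literature.NumberTheory.Transcendental
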